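import Summits.Ventures.CertifiedManyBodySolver.Observables.SourcedGibbsTrialCapHFBCS
import Literature.MathematicalPhysics.QuantumLattice.FreeFermionSpinTwistedTraceFormula
import Literature.MathematicalPhysics.QuantumLattice.FermionLiebRobinson
import HarnessLib

/-!
# A SOURCED CAP for the pinning-field bracket (VIII): SPIN-WEIGHTED quasi-free trial states
# (the antiferromagnetic / spin-density-wave + `d`-wave-pinned BCS Hartree–Fock cap, finite torus, exact)

HONEST FRAMING: zero compute; every statement is a PROVED finite-volume identity / inequality; no number is claimed.
The trial state is the Gibbs state of the FREE pinned torus Hamiltonian PLUS an arbitrary real one-body spin field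
`Σ_x w_x (n_{x↑} − n_{x↓})` (for `w_x = M·(−1)^x` the commensurate antiferromagnetic = spin-density-wave trial family of
generalized Hartree–Fock theory); the field is a VARIATIONAL DEVICE only — the capped object is the ground-state energy of
the translation-invariant, SU(2)-invariant pinned Hubbard torus `A_L(U, μ, h)`; nothing is claimed about magnetic order.
A sourced cap feeds the FLOOR edge of the Hellmann–Feynman bracket; not a statement about order of the source-free
model; not a superconductivity verdict.

Cell `hubbard-obs` (D-0042 / D-0082), seat `hubbard-obs-pin-2` (`prover-hubbard-obs-pin-2-g7-0`); sequel of
`Observables/SourcedGibbsTrialCapHFBCS.lean` (§5 `groundEnergy_le_HFBCS_of_conj`: the generalized-Hartree–Fock cap with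
a spin-INDEPENDENT trial Hamiltonian). Motivation (float planning of this seat, kit j288382, labelled float): at
`(U, n) = (6…8, 7/8)` the spin-density-wave trial family lowers the quasi-free cap by `0.2–0.45 t` per site at pair
fields `h ≤ 0.4 t`, where the paramagnetic cap is `≥ 0.25 t` slack — the weak zone of the Hartree–Fock instrument.

## Contents

* §6 `gibbsState_spinField_of_conj`: under `W A Wᴴ = dΓ(𝓗) − c·1`, `⟨Σ_x w_x (n_{x↑} − n_{x↓})⟩_{β,A}
  = Σ_x w_x (F_{x↑,x↑} − 1 + F_{x↓,x↓})`, `F = (1 + e^{β𝓗})⁻¹` (§3 transport).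
* §6 `groundEnergy_le_HFBCS_spinField_of_conj` — GENERIC generalized-Hartree–Fock cap with a spin field in the
  decomposition: `A' = A + a·N + U·Σ_x n_{x↑}n_{x↓} + Σ_x w_x (n_{x↑} − n_{x↓})`, `W A Wᴴ = dΓ(𝓗) − c·1` ⇒
  `E₀(A') ≤ Re(Σ 𝓗_{ij}F_{ji} − c) + a·Re Σ_x(F_{x↑,x↑} + 1 − F_{x↓,x↓}) + U·Re Σ_x(F_{x↑,x↑}(1 − F_{x↓,x↓}) + F_{x↓,x↑}F_{x↑,x↓})
  + Re Σ_x w_x (F_{x↑,x↑} − 1 + F_{x↓,x↓})` (any finite lattice, any hopping, any pair field, any `w`).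
* §7 `partialParticleHole_conj_spinField` (`W Σ_x w_x(n_{x↑} − n_{x↓}) Wᴴ = dΓ(diag w ⊗ 1_spin) − (Σ_x w_x)·1`),
  `spinFieldTorus_conj_nambu` (Nambu data of the free pinned torus PLUS the spin field:
  `𝓗 = 𝓗_{L,μ',h} + diag(w)`, `c = μ'L² + Σ_x w_x`), `isHermitian_dWaveNambu_add_spinField`,
  `dWaveSourceTorus_eq_spinTrial_add` (`A_L(U,μ,h) = (A_L(0,μ',h) + Σ w(n↑ − n↓)) + (μ'−μ)N + U·D + Σ (−w)(n↑ − n↓)`).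
* §8 PUBLIC `groundEnergy_dWaveSourceTorus_le_HFBCS_spinField (L) (U μ μ' h β) (w)`: the spin-density-wave +
  `d`-wave-pinned BCS generalized-Hartree–Fock cap of the pinned Hubbard torus in one-body form, library instances
  (plugs into the `hcap` slots exactly like `groundEnergy_dWaveSourceTorus_le_HFBCS`; `w = 0` recovers it).
  What remains for a NUMBER: for `w_x = M(−1)^x` and even `L` the Nambu matrix block-diagonalises over momentum
  PAIRS `(k, k+Q)` (`4 × 4` blocks whose square is `2 × 2`-block-diagonal, `E_±(k) = √((√(ε_k² + M²) ± μ')² + Δ_k²)`);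
  certify the resulting three per-site sums; choose `(β, μ', M)` — the successor files of this chain.

References: V. Bach, E. H. Lieb, J. P. Solovej, J. Stat. Phys. 76 (1994) 3, §2 (generalized HF states and their
energy functional; eqs. (2c.8)–(2c.10)) [BachLiebSolovej1994]; E. H. Lieb, PRL 62 (1989) 1201, proof of Thm 2 (the
partial particle–hole transformation) [Lieb1989]; M. Gaudin, Nucl. Phys. 15 (1960) 89 [Gaudin1960]; J. E. Hirsch,
Phys. Rev. B 31 (1985) 4403 (mean-field spin-density-wave states of the 2D Hubbard model vs simulation) [HirschPRB1985];
O. Bratteli, D. W. Robinson, *OAQSM 2* (1997) §5.2.4 [BratteliRobinsonII1997].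
-/

noncomputable section

namespace Summit.Ventures.CertifiedManyBodySolver.Observables

open Matrix Literature.MathematicalPhysics.QuantumLattice Literature.Probability.LatticeModels
open Literature.MathematicalPhysics.QuantumLattice.HubbardWave0
open Literature.Barriers.HubbardSuperconductivity (IsDensityMatrix)
open scoped ComplexOrder BigOperators

/-! ### §6 The generalized-Hartree–Fock cap with a one-body spin field in the decomposition -/

section SpinField

variable {Λ : Type*} [LinearOrder Λ] [Fintype Λ]

/-- **Spin-field expectation = Fermi-matrix diagonal**: under `W A Wᴴ = dΓ(𝓗) − c·1` with `𝓗` Hermitian,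
`⟨Σ_x w_x (n_{x↑} − n_{x↓})⟩_{β,A} = Σ_x w_x (F_{x↑,x↑} − 1 + F_{x↓,x↓})`, `F = (1 + e^{β𝓗})⁻¹`
(`⟨n_{x↑}⟩ = F_{x↑,x↑}`, `⟨n_{x↓}⟩ = 1 − F_{x↓,x↓}`, §3). [cite: BratteliRobinsonII1997, §5.2.4] [cite: Lieb1989, proof of Theorem 2] -/
theorem gibbsState_spinField_of_conj
    {A : Matrix (Finset (Orb Λ)) (Finset (Orb Λ)) ℂ}
    {𝓗 : Matrix (Orb Λ) (Orb Λ) ℂ} (h𝓗 : 𝓗.IsHermitian) {c : ℂ}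
    (hA : partialParticleHole (spinDownOrbitals : Finset (Orb Λ)) * A *
      (partialParticleHole (spinDownOrbitals : Finset (Orb Λ)))ᴴ = dGamma 𝓗 - c • 1)
    (β : ℝ) (w : Λ → ℝ) :
    gibbsState β A (∑ x : Λ, (w x : ℂ) • (numberOp x 0 - numberOp x 1)) =
      ∑ x : Λ, (w x : ℂ) * ((1 + NormedSpace.exp ((β : ℂ) • 𝓗))⁻¹ (orb x 0) (orb x 0) - 1 +
        (1 + NormedSpace.exp ((β : ℂ) • 𝓗))⁻¹ (orb x 1) (orb x 1)) := by
  rw [map_sum]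
  refine Finset.sum_congr rfl fun x _ => ?_
  rw [LinearMap.map_smul_of_tower, smul_eq_mul, map_sub, gibbsState_numberOp_up_of_conj h𝓗 hA,
    gibbsState_numberOp_down_of_conj h𝓗 hA]
  ring

/-- **Generalized-Hartree–Fock cap with a spin field, GENERIC form.** Let
`A' = A + a·N + U·Σ_x n_{x↑}n_{x↓} + Σ_x w_x (n_{x↑} − n_{x↓})` with `A`, `A'` Hermitian, `w` real (the interacting
pinned Hamiltonian `A'` versus a quasi-free trial Hamiltonian `A` that CONTAINS the opposite spin field — e.g. the
spin-density-wave field `−w`), and let `W A Wᴴ = dΓ(𝓗) − c·1` with `𝓗` Hermitian. Then for every real `β`, with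
`F = (1 + e^{β𝓗})⁻¹`:
`E₀(A') ≤ Re(Σ_{ij} 𝓗_{ij}F_{ji} − c) + a·Re Σ_x (F_{x↑,x↑} + 1 − F_{x↓,x↓}) + U·Re Σ_x (F_{x↑,x↑}(1 − F_{x↓,x↓}) + F_{x↓,x↑}F_{x↑,x↓})
          + Re Σ_x w_x (F_{x↑,x↑} − 1 + F_{x↓,x↓})`
(Gibbs trial state of `A`; Bach–Lieb–Solovej's generalized-HF energy of a spin-polarised quasi-free state bounds the
interacting ground energy). Any finite lattice, any pair field, any hopping, any spin field.
[cite: BachLiebSolovej1994, §2] [cite: Gaudin1960] [cite: Lieb1989, proof of Theorem 2] -/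
theorem groundEnergy_le_HFBCS_spinField_of_conj {A A' : Matrix (Finset (Orb Λ)) (Finset (Orb Λ)) ℂ}
    (hA' : A'.IsHermitian) (hAh : A.IsHermitian) {a U : ℝ} (w : Λ → ℝ)
    (hdec : A' = A + (a : ℂ) • totalNumber + (U : ℂ) • ∑ x : Λ, numberOp x 0 * numberOp x 1 +
      ∑ x : Λ, (w x : ℂ) • (numberOp x 0 - numberOp x 1))
    {𝓗 : Matrix (Orb Λ) (Orb Λ) ℂ} (h𝓗 : 𝓗.IsHermitian) {c : ℂ}
    (hA : partialParticleHole (spinDownOrbitals : Finset (Orb Λ)) * A *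
      (partialParticleHole (spinDownOrbitals : Finset (Orb Λ)))ᴴ = dGamma 𝓗 - c • 1) (β : ℝ) :
    A'.groundEnergy ≤
      ((∑ i : Orb Λ, ∑ j : Orb Λ, 𝓗 i j * (1 + NormedSpace.exp ((β : ℂ) • 𝓗))⁻¹ j i) - c).re +
        a * (∑ x : Λ,
          ((1 + NormedSpace.exp ((β : ℂ) • 𝓗))⁻¹ (orb x 0) (orb x 0) +
            (1 - (1 + NormedSpace.exp ((β : ℂ) • 𝓗))⁻¹ (orb x 1) (orb x 1)))).re +
        U * (∑ x : Λ,
          ((1 + NormedSpace.exp ((β : ℂ) • 𝓗))⁻¹ (orb x 0) (orb x 0) *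
              (1 - (1 + NormedSpace.exp ((β : ℂ) • 𝓗))⁻¹ (orb x 1) (orb x 1)) +
            (1 + NormedSpace.exp ((β : ℂ) • 𝓗))⁻¹ (orb x 1) (orb x 0) *
              (1 + NormedSpace.exp ((β : ℂ) • 𝓗))⁻¹ (orb x 0) (orb x 1))).re +
        (∑ x : Λ, (w x : ℂ) * ((1 + NormedSpace.exp ((β : ℂ) • 𝓗))⁻¹ (orb x 0) (orb x 0) - 1 +
          (1 + NormedSpace.exp ((β : ℂ) • 𝓗))⁻¹ (orb x 1) (orb x 1))).re := by
  haveI : Nonempty (Finset (Orb Λ)) := ⟨∅⟩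
  have hle := groundEnergy_le_re_gibbsState β hA' hAh
  have hexp : gibbsState β A A' = gibbsState β A A + (a : ℂ) * gibbsState β A totalNumber +
      (U : ℂ) * gibbsState β A (∑ x : Λ, numberOp x 0 * numberOp x 1) +
      gibbsState β A (∑ x : Λ, (w x : ℂ) • (numberOp x 0 - numberOp x 1)) := by
    rw [hdec, map_add, map_add, map_add, LinearMap.map_smul_of_tower, LinearMap.map_smul_of_tower, smul_eq_mul,
      smul_eq_mul]
  have e3 : gibbsState β A (∑ x : Λ, numberOp x 0 * numberOp x 1) =
      ∑ x : Λ, ((1 + NormedSpace.exp ((β : ℂ) • 𝓗))⁻¹ (orb x 0) (orb x 0) *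
            (1 - (1 + NormedSpace.exp ((β : ℂ) • 𝓗))⁻¹ (orb x 1) (orb x 1)) +
          (1 + NormedSpace.exp ((β : ℂ) • 𝓗))⁻¹ (orb x 1) (orb x 0) *
            (1 + NormedSpace.exp ((β : ℂ) • 𝓗))⁻¹ (orb x 0) (orb x 1)) := by
    rw [map_sum]
    exact Finset.sum_congr rfl fun x _ => gibbsState_docc_of_conj h𝓗 hA β x
  rw [hexp, gibbsState_self_of_conj h𝓗 hA, gibbsState_totalNumber_of_conj h𝓗 hA, e3,
    gibbsState_spinField_of_conj h𝓗 hA β w, Complex.add_re, Complex.add_re, Complex.add_re,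
    Complex.re_ofReal_mul, Complex.re_ofReal_mul] at hle
  exact hle

/-! ### §7 Nambu data of a quasi-free trial Hamiltonian with a spin field -/

/-- **The spin field under the partial particle–hole transformation**: `W n_{x↑} Wᴴ = n_{x↑}`,
`W n_{x↓} Wᴴ = 1 − n_{x↓}`, hence `W (Σ_x w_x (n_{x↑} − n_{x↓})) Wᴴ = dΓ(diag(x,σ ↦ w_x)) − (Σ_x w_x)·1`:
a spin (Zeeman-type) field becomes a spin-independent POTENTIAL in the Nambu picture.
[cite: Lieb1989, proof of Theorem 2] -/
theorem partialParticleHole_conj_spinField (w : Λ → ℝ) :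
    partialParticleHole (spinDownOrbitals : Finset (Orb Λ)) * (∑ x : Λ, (w x : ℂ) • (numberOp x 0 - numberOp x 1)) *
        (partialParticleHole (spinDownOrbitals : Finset (Orb Λ)))ᴴ =
      dGamma (diagonal fun i : Orb Λ => (w (ofLex i).1 : ℂ)) -
        (∑ x : Λ, (w x : ℂ)) • (1 : Matrix (Finset (Orb Λ)) (Finset (Orb Λ)) ℂ) := by
  rw [partialParticleHole_conj_sum, dGamma_diagonal, sum_orb_eq_sum_sum, Finset.sum_smul, ← Finset.sum_sub_distrib]
  refine Finset.sum_congr rfl fun x _ => ?_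
  rw [partialParticleHole_conj_smul, Matrix.mul_sub, Matrix.sub_mul, partialParticleHole_conj_numberOp_up,
    partialParticleHole_conj_numberOp_down, Fin.sum_univ_two]
  simp only [ofLex_orb, numberAt_orb, smul_sub]
  abel

omit [Fintype Λ] in
/-- `diag(x,σ ↦ w_x)` is Hermitian for real `w`. [folklore] -/
theorem isHermitian_diagonal_spinField (w : Λ → ℝ) :
    (diagonal fun i : Orb Λ => (w (ofLex i).1 : ℂ)).IsHermitian := by
  refine isHermitian_diagonal_of_self_adjoint _ (funext fun i => ?_)
  simp only [Pi.star_apply, Complex.star_def, Complex.conj_ofReal]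

/-- **Nambu data with a spin field**: if `W A Wᴴ = dΓ(𝓗) − c·1` then
`W (A + Σ_x w_x (n_{x↑} − n_{x↓})) Wᴴ = dΓ(𝓗 + diag(x,σ ↦ w_x)) − (c + Σ_x w_x)·1`.
[cite: Lieb1989, proof of Theorem 2] [cite: BachLiebSolovej1994, §2] -/
theorem conj_nambu_add_spinField {A : Matrix (Finset (Orb Λ)) (Finset (Orb Λ)) ℂ}
    {𝓗 : Matrix (Orb Λ) (Orb Λ) ℂ} {c : ℂ}
    (hA : partialParticleHole (spinDownOrbitals : Finset (Orb Λ)) * A *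
      (partialParticleHole (spinDownOrbitals : Finset (Orb Λ)))ᴴ = dGamma 𝓗 - c • 1) (w : Λ → ℝ) :
    partialParticleHole (spinDownOrbitals : Finset (Orb Λ)) *
        (A + ∑ x : Λ, (w x : ℂ) • (numberOp x 0 - numberOp x 1)) *
        (partialParticleHole (spinDownOrbitals : Finset (Orb Λ)))ᴴ =
      dGamma (𝓗 + diagonal fun i : Orb Λ => (w (ofLex i).1 : ℂ)) -
        (c + ∑ x : Λ, (w x : ℂ)) • (1 : Matrix (Finset (Orb Λ)) (Finset (Orb Λ)) ℂ) := by
  rw [Matrix.mul_add, Matrix.add_mul, hA, partialParticleHole_conj_spinField, dGamma_add, add_smul]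
  abel

end SpinField

/-! ### §8 The public statement: the spin-density-wave + `d`-wave-pinned BCS Hartree–Fock cap of the torus -/

section Public

variable (L : ℕ) [NeZero L]

/-- **Decomposition of the pinned torus around a spin-field trial Hamiltonian**:
`A_L(U,μ,h) = (A_L(0,μ',h) + Σ_x w_x (n_{x↑} − n_{x↓})) + (μ' − μ)·N_L + U·Σ_x n_{x↑}n_{x↓} + Σ_x (−w_x)(n_{x↑} − n_{x↓})`.
[cite: BachLiebSolovej1994, §2] -/
theorem dWaveSourceTorus_eq_spinTrial_add (U μ μ' h : ℝ) (w : FermionTorus 2 L → ℝ) :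
    dWaveSourceTorus L U μ h =
      (dWaveSourceTorus L 0 μ' h + ∑ x : FermionTorus 2 L, (w x : ℂ) • (numberOp x 0 - numberOp x 1)) +
        ((μ' - μ : ℝ) : ℂ) • totalNumber + (U : ℂ) • ∑ x : FermionTorus 2 L, numberOp x 0 * numberOp x 1 +
        ∑ x : FermionTorus 2 L, ((-w x : ℝ) : ℂ) • (numberOp x 0 - numberOp x 1) := by
  rw [dWaveSourceTorus_eq_free_add L U μ μ' h]
  simp only [Complex.ofReal_neg, neg_smul, Finset.sum_neg_distrib]
  abel

/-- The spin-field trial Hamiltonian `A_L(0,μ',h) + Σ_x w_x (n_{x↑} − n_{x↓})` is Hermitian (`w` real). [folklore] -/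
theorem isHermitian_dWaveSourceTorus_add_spinField (μ' h : ℝ) (w : FermionTorus 2 L → ℝ) :
    (dWaveSourceTorus L 0 μ' h + ∑ x : FermionTorus 2 L, (w x : ℂ) • (numberOp x 0 - numberOp x 1)).IsHermitian := by
  refine (dWaveSourceTorus_isHermitian L (isHermitian_hubbardTorusWith L 1 0 μ') h).add ?_
  refine isHermitian_finset_sum (Finset.univ) fun x _ => ?_
  refine IsHermitian.smul (((numberAt_isHermitian (orb x 0)).sub (numberAt_isHermitian (orb x 1)))) ?_
  rw [isSelfAdjoint_iff, Complex.star_def, Complex.conj_ofReal]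

/-- **Nambu data of the free `d`-wave pinned torus PLUS a spin field**:
`W (A_L(0,μ',h) + Σ_x w_x(n_{x↑} − n_{x↓})) Wᴴ = dΓ(𝓗_{L,μ',h} + diag(w)) − (μ'L² + Σ_x w_x)·1`.
[cite: Lieb1989, proof of Theorem 2] -/
theorem spinFieldTorus_conj_nambu (μ' h : ℝ) (w : FermionTorus 2 L → ℝ) :
    partialParticleHole (spinDownOrbitals : Finset (Orb (FermionTorus 2 L))) *
        (dWaveSourceTorus L 0 μ' h + ∑ x : FermionTorus 2 L, (w x : ℂ) • (numberOp x 0 - numberOp x 1)) *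
        (partialParticleHole (spinDownOrbitals : Finset (Orb (FermionTorus 2 L))))ᴴ =
      dGamma (bdgNambuMatrix
          (fun x y => if (fermionTorusGraph 2 L).Adj x y then -(1 : ℂ) else 0)
          (fun u v : FermionTorus 2 L => -(h : ℂ) * ∑ i : Fin 2,
            if v = FermionTorus.ofTorusSite (u.toTorusSite + Pi.single i 1) then
              ((Real.sqrt 2 * (if i = 0 then 1 else -1) : ℝ) : ℂ) else 0) μ' +
          diagonal fun i : Orb (FermionTorus 2 L) => (w (ofLex i).1 : ℂ)) -
        ((μ' : ℂ) * (L : ℂ) ^ 2 + ∑ x : FermionTorus 2 L, (w x : ℂ)) •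
          (1 : Matrix (Finset (Orb (FermionTorus 2 L))) (Finset (Orb (FermionTorus 2 L))) ℂ) := by
  -- the library `DecidableEq` of the concrete torus versus the `LinearOrder`-derived one of the generic lemma
  convert conj_nambu_add_spinField (Λ := FermionTorus 2 L) (c := (μ' : ℂ) * (L : ℂ) ^ 2)
    (by convert dWaveSource_free_conj_nambu L μ' h using 7) w using 7

/-- The Nambu matrix of the `d`-wave pinned torus plus a real spin field is Hermitian. [cite: BachLiebSolovej1994, §2] -/
theorem isHermitian_dWaveNambu_add_spinField (μ' h : ℝ) (w : FermionTorus 2 L → ℝ) :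
    (bdgNambuMatrix
        (fun x y => if (fermionTorusGraph 2 L).Adj x y then -(1 : ℂ) else 0)
        (fun u v : FermionTorus 2 L => -(h : ℂ) * ∑ i : Fin 2,
          if v = FermionTorus.ofTorusSite (u.toTorusSite + Pi.single i 1) then
            ((Real.sqrt 2 * (if i = 0 then 1 else -1) : ℝ) : ℂ) else 0) μ' +
        diagonal fun i : Orb (FermionTorus 2 L) => (w (ofLex i).1 : ℂ)).IsHermitian :=
  -- the library `DecidableEq` of the concrete torus versus the `LinearOrder`-derived one of the generic lemma
  (isHermitian_dWaveNambu L μ' h).add (by convert isHermitian_diagonal_spinField (Λ := FermionTorus 2 L) w using 3)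

/-- **Spin-density-wave + `d`-wave-pinned BCS Hartree–Fock sourced cap for the pinned Hubbard torus (finite torus,
exact; library instances).** For every real `β`, trial chemical potential `μ'` and real spin field `w` on the torus,
with the Nambu matrix `𝓗 = 𝓗_{L,μ',h} + diag(w)` of the free pinned torus plus the field (`spinFieldTorus_conj_nambu`)
and `F = (1 + e^{β𝓗})⁻¹`:
`E₀(A_L(U,μ,h)) ≤ Re(Σ_{ij} 𝓗_{ij}F_{ji} − μ'L² − Σ_x w_x) + (μ'−μ)·Re Σ_x (F_{x↑,x↑} + 1 − F_{x↓,x↓})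
                 + U·Re Σ_x (F_{x↑,x↑}(1 − F_{x↓,x↓}) + F_{x↓,x↑}F_{x↑,x↓}) + Re Σ_x (−w_x)(F_{x↑,x↑} − 1 + F_{x↓,x↓})`
— the generalized-Hartree–Fock energy of the spin-polarised pinned quasi-free state bounds the interacting pinned
ground energy; `w = 0` is `groundEnergy_dWaveSourceTorus_le_HFBCS`; `w_x = M(−1)^x` (even `L`) is the commensurate
antiferromagnetic trial family of this seat's strong-coupling cap. A SOURCED CAP for the Hellmann–Feynman floor edge once
the one-body sums are certified (plugs into the `hcap` slots at a fixed `L`). The field is a variational device; nothing is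
claimed about magnetic order of `A_L`. [cite: BachLiebSolovej1994, §2] [cite: HirschPRB1985] [cite: Lieb1989, proof of Theorem 2] -/
theorem groundEnergy_dWaveSourceTorus_le_HFBCS_spinField (U μ μ' h β : ℝ) (w : FermionTorus 2 L → ℝ) :
    (dWaveSourceTorus L U μ h).groundEnergy ≤
      ((∑ i : Orb (FermionTorus 2 L), ∑ j : Orb (FermionTorus 2 L),
          (bdgNambuMatrix
              (fun x y => if (fermionTorusGraph 2 L).Adj x y then -(1 : ℂ) else 0)
              (fun u v : FermionTorus 2 L => -(h : ℂ) * ∑ i : Fin 2,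
                if v = FermionTorus.ofTorusSite (u.toTorusSite + Pi.single i 1) then
                  ((Real.sqrt 2 * (if i = 0 then 1 else -1) : ℝ) : ℂ) else 0) μ' +
            diagonal fun i : Orb (FermionTorus 2 L) => (w (ofLex i).1 : ℂ)) i j *
            (1 + NormedSpace.exp ((β : ℂ) • (bdgNambuMatrix
              (fun x y => if (fermionTorusGraph 2 L).Adj x y then -(1 : ℂ) else 0)
              (fun u v : FermionTorus 2 L => -(h : ℂ) * ∑ i : Fin 2,
                if v = FermionTorus.ofTorusSite (u.toTorusSite + Pi.single i 1) then
                  ((Real.sqrt 2 * (if i = 0 then 1 else -1) : ℝ) : ℂ) else 0) μ' +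
              diagonal fun i : Orb (FermionTorus 2 L) => (w (ofLex i).1 : ℂ))))⁻¹ j i) -
          ((μ' : ℂ) * (L : ℂ) ^ 2 + ∑ x : FermionTorus 2 L, (w x : ℂ))).re +
        (μ' - μ) * (∑ x : FermionTorus 2 L,
          ((1 + NormedSpace.exp ((β : ℂ) • (bdgNambuMatrix
              (fun x y => if (fermionTorusGraph 2 L).Adj x y then -(1 : ℂ) else 0)
              (fun u v : FermionTorus 2 L => -(h : ℂ) * ∑ i : Fin 2,
                if v = FermionTorus.ofTorusSite (u.toTorusSite + Pi.single i 1) then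
                  ((Real.sqrt 2 * (if i = 0 then 1 else -1) : ℝ) : ℂ) else 0) μ' +
              diagonal fun i : Orb (FermionTorus 2 L) => (w (ofLex i).1 : ℂ))))⁻¹ (orb x 0) (orb x 0) +
            (1 - (1 + NormedSpace.exp ((β : ℂ) • (bdgNambuMatrix
              (fun x y => if (fermionTorusGraph 2 L).Adj x y then -(1 : ℂ) else 0)
              (fun u v : FermionTorus 2 L => -(h : ℂ) * ∑ i : Fin 2,
                if v = FermionTorus.ofTorusSite (u.toTorusSite + Pi.single i 1) then
                  ((Real.sqrt 2 * (if i = 0 then 1 else -1) : ℝ) : ℂ) else 0) μ' +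
              diagonal fun i : Orb (FermionTorus 2 L) => (w (ofLex i).1 : ℂ))))⁻¹ (orb x 1) (orb x 1)))).re +
        U * (∑ x : FermionTorus 2 L,
          ((1 + NormedSpace.exp ((β : ℂ) • (bdgNambuMatrix
              (fun x y => if (fermionTorusGraph 2 L).Adj x y then -(1 : ℂ) else 0)
              (fun u v : FermionTorus 2 L => -(h : ℂ) * ∑ i : Fin 2,
                if v = FermionTorus.ofTorusSite (u.toTorusSite + Pi.single i 1) then
                  ((Real.sqrt 2 * (if i = 0 then 1 else -1) : ℝ) : ℂ) else 0) μ' +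
              diagonal fun i : Orb (FermionTorus 2 L) => (w (ofLex i).1 : ℂ))))⁻¹ (orb x 0) (orb x 0) *
              (1 - (1 + NormedSpace.exp ((β : ℂ) • (bdgNambuMatrix
              (fun x y => if (fermionTorusGraph 2 L).Adj x y then -(1 : ℂ) else 0)
              (fun u v : FermionTorus 2 L => -(h : ℂ) * ∑ i : Fin 2,
                if v = FermionTorus.ofTorusSite (u.toTorusSite + Pi.single i 1) then
                  ((Real.sqrt 2 * (if i = 0 then 1 else -1) : ℝ) : ℂ) else 0) μ' +
              diagonal fun i : Orb (FermionTorus 2 L) => (w (ofLex i).1 : ℂ))))⁻¹ (orb x 1) (orb x 1)) +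
            (1 + NormedSpace.exp ((β : ℂ) • (bdgNambuMatrix
              (fun x y => if (fermionTorusGraph 2 L).Adj x y then -(1 : ℂ) else 0)
              (fun u v : FermionTorus 2 L => -(h : ℂ) * ∑ i : Fin 2,
                if v = FermionTorus.ofTorusSite (u.toTorusSite + Pi.single i 1) then
                  ((Real.sqrt 2 * (if i = 0 then 1 else -1) : ℝ) : ℂ) else 0) μ' +
              diagonal fun i : Orb (FermionTorus 2 L) => (w (ofLex i).1 : ℂ))))⁻¹ (orb x 1) (orb x 0) *
              (1 + NormedSpace.exp ((β : ℂ) • (bdgNambuMatrix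
              (fun x y => if (fermionTorusGraph 2 L).Adj x y then -(1 : ℂ) else 0)
              (fun u v : FermionTorus 2 L => -(h : ℂ) * ∑ i : Fin 2,
                if v = FermionTorus.ofTorusSite (u.toTorusSite + Pi.single i 1) then
                  ((Real.sqrt 2 * (if i = 0 then 1 else -1) : ℝ) : ℂ) else 0) μ' +
              diagonal fun i : Orb (FermionTorus 2 L) => (w (ofLex i).1 : ℂ))))⁻¹ (orb x 0) (orb x 1))).re +
        (∑ x : FermionTorus 2 L, ((-w x : ℝ) : ℂ) *
          ((1 + NormedSpace.exp ((β : ℂ) • (bdgNambuMatrix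
              (fun x y => if (fermionTorusGraph 2 L).Adj x y then -(1 : ℂ) else 0)
              (fun u v : FermionTorus 2 L => -(h : ℂ) * ∑ i : Fin 2,
                if v = FermionTorus.ofTorusSite (u.toTorusSite + Pi.single i 1) then
                  ((Real.sqrt 2 * (if i = 0 then 1 else -1) : ℝ) : ℂ) else 0) μ' +
              diagonal fun i : Orb (FermionTorus 2 L) => (w (ofLex i).1 : ℂ))))⁻¹ (orb x 0) (orb x 0) - 1 +
            (1 + NormedSpace.exp ((β : ℂ) • (bdgNambuMatrix
              (fun x y => if (fermionTorusGraph 2 L).Adj x y then -(1 : ℂ) else 0)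
              (fun u v : FermionTorus 2 L => -(h : ℂ) * ∑ i : Fin 2,
                if v = FermionTorus.ofTorusSite (u.toTorusSite + Pi.single i 1) then
                  ((Real.sqrt 2 * (if i = 0 then 1 else -1) : ℝ) : ℂ) else 0) μ' +
              diagonal fun i : Orb (FermionTorus 2 L) => (w (ofLex i).1 : ℂ))))⁻¹ (orb x 1) (orb x 1))).re := by
  have key := groundEnergy_le_HFBCS_spinField_of_conj (Λ := FermionTorus 2 L)
    (dWaveSourceTorus_isHermitian L (isHermitian_hubbardTorusWith L 1 U μ) h)
    (isHermitian_dWaveSourceTorus_add_spinField L μ' h w) (fun x => -w x)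
    (dWaveSourceTorus_eq_spinTrial_add L U μ μ' h w) (isHermitian_dWaveNambu_add_spinField L μ' h w)
    (c := (μ' : ℂ) * (L : ℂ) ^ 2 + ∑ x : FermionTorus 2 L, (w x : ℂ)) (by
      convert spinFieldTorus_conj_nambu L μ' h w using 7) β
  convert key using 40

end Public

end Summit.Ventures.CertifiedManyBodySolver.Observables

end
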